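import Mathlib
import Summits.Ventures.PercRepro2.Defs
import Summits.Ventures.PercRepro2.Graph
import Summits.Ventures.PercRepro2.OneColourSwitch
import Summits.Ventures.PercRepro2.RegionHubSign
import Summits.Ventures.PercRepro2.SideSwitch
import Summits.Ventures.PercRepro2.SideSwitchFibre
import Summits.Ventures.PercRepro2.SideSwitchMono
import Summits.Ventures.PercRepro2.SideSwitchM9
import Summits.Ventures.PercRepro2.SideSwitchClosed
import Summits.Ventures.PercRepro2.SideSwitchComps
import Summits.Ventures.PercRepro2.SideSwitchCompsFibre
import Summits.Ventures.PercRepro2.M9LatticeHarrisGen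
import Summits.Ventures.PercRepro2.M9LatticeHarrisSub
import Summits.Ventures.PercRepro2.M9NoPocketDefs
import Summits.Ventures.PercRepro2.M9NoPocketWorld
import Summits.Ventures.PercRepro2.M9NoPocketWorldD
import Summits.Ventures.PercRepro2.M9NoPocketLegal
import Summits.Ventures.PercRepro2.M9NoPocketFibre
import Summits.Ventures.PercRepro2.M9NoPocketMono
import Summits.Ventures.PercRepro2.M9NoPocketCompl
import Summits.Ventures.PercRepro2.M9NoPocketFlipRS
import Summits.Ventures.PercRepro2.M9NoPocketCompl2
import Summits.Ventures.PercRepro2.M9NoPocketHarris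

/-!
# `m9` on the single-`d` class without a pocket — the theorem (blind cell PercRepro2, p3 g20,
2026-08-27; `proofs/P3-CPNC.md` §17c)

For a finite marked multigraph and a non-mark `d` every neighbour of which (other than `r, s`)
is adjacent to `r` or `s`: `Σ_{ω ∈ Sep, D(ω) ⊆ {d}} σ_pq · σ_rs ≤ 0` (`dSignSum_nonpos_of_noPocket`),
and `m9 ≤ 0` when moreover every non-mark other than `d` is adjacent to `p` or `q`
(`m9SignSum_nonpos_of_singleD_noPocket`).  Proof: the fibration of `M9NoPocketFibre`, the
complement identity for `p ~ q` (`conn_pq_compl_assignX`, from `M9NoPocketCompl2`), the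
per-representative identity `σ_pq(ρ_x) + σ_pq(ρ^O_x) = G(x) − G(cdual x)` with `G` increasing
and `σ_rs` decreasing on the legal vectors (`M9NoPocketMono`, `M9NoPocketFlipRS`), and Harris on
the self-dual sublattice of legal vectors (`M9NoPocketHarris`).  Own work; std axioms.
-/

namespace Summit.Ventures.PercRepro2

namespace NoPocket

open Finset Classical RegionHub OneColourSwitch SideSwitch M9Reduce

variable {V : Type*} {E : Type*}

section Theorem

variable [Fintype V] [DecidableEq V] [Fintype E] [DecidableEq E]

variable {ends : E → Sym2 V}

/-- **The complement identity for `p ~ q`**: `p ~_W q` in the assignment `x` is `p ~_Y q` in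
the dual assignment of the outside-flipped representative. -/
theorem conn_pq_compl_assignX {p q r s d : V} (hnp : NoPocketAt ends d r s) (hpd : p ≠ d)
    (hqd : q ≠ d) (hr : d ≠ r) (hs : d ≠ s) {ρ : Config E} (hρ : ρ ∈ RepD ends p q r s d)
    {x : Finset (Finset V) × Finset E} (hx : x ∈ L4 ends d r s ρ) :
    Conn ends (OneColourSwitch.compl (assignX ends x ρ)) p q ↔
      Conn ends (assignX ends (cdual ends d r s ρ x) (flipOp ends d r s ρ)) p q := by
  obtain ⟨⟨hT, hF⟩, _, _⟩ := mem_L4.1 hx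
  have hρO := flipOp_mem_RepD hr hs hρ
  have hxc : cdual ends d r s ρ x ∈ L4 ends d r s (flipOp ends d r s ρ) := by
    rw [L4_flipOp hr hs]; exact cdual_mem_L4 hx
  have hsep := (mem_DOneSet.1 (mem_DOneSet_assignX_of_mem_L4 hnp hpd hqd hr hs hρ hx)).1
  have hsepc := (mem_DOneSet.1 (mem_DOneSet_assignX_of_mem_L4 hnp hpd hqd hr hs hρO hxc)).1
  have hpt : ∀ {e : E}, e ∉ within ends ({r, s} : Set V) →
      OneColourSwitch.compl (assignX ends x ρ) e =
        assignX ends (cdual ends d r s ρ x) (flipOp ends d r s ρ) e :=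
    fun he => compl_assignX_eq_off_rs hnp hr hs hρ hT hF he
  have hrs_touch : ∀ {ω : Config E} {e : E}, e ∈ within ends ({r, s} : Set V) →
      e ∈ touches ends (K2 ends r s ω) := by
    intro ω e hrs
    obtain ⟨z, hz, w, _, hzw⟩ := hrs
    refine ⟨z, ?_, w, hzw⟩
    rcases Set.mem_insert_iff.1 hz with rfl | hz'
    · exact r_mem_K2 _ _ _
    · rw [Set.mem_singleton_iff.1 hz']; exact s_mem_K2 _ _ _
  constructor
  · intro hc
    refine conn_of_eqOn_notTouches (H := ({r, s} : Set V))
      (ω := OneColourSwitch.compl (assignX ends x ρ)) (not_mem_M2_of_sep2 hsep).1 ?_ hc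
    intro e he
    exact (hpt (fun hrs => he (hrs_touch hrs))).symm
  · intro hc
    refine conn_of_eqOn_notTouches (H := ({r, s} : Set V))
      (ω := assignX ends (cdual ends d r s ρ x) (flipOp ends d r s ρ))
      (not_mem_K2_of_sep2 hsepc).1 ?_ hc
    intro e he
    exact hpt (fun hrs => he (hrs_touch hrs))

/-- The `p ~_Y q` indicator of an assignment. -/
noncomputable def Yc (ends : E → Sym2 V) (p q : V) (ρ : Config E)
    (x : Finset (Finset V) × Finset E) : ℤ :=
  if Conn ends (assignX ends x ρ) p q then 1 else 0

/-- The increasing function of the Harris step: `Yc_ρ + Yc_{ρ^O}`. -/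
noncomputable def Gfun (ends : E → Sym2 V) (p q r s d : V) (ρ : Config E)
    (x : Finset (Finset V) × Finset E) : ℤ :=
  Yc ends p q ρ x + Yc ends p q (flipOp ends d r s ρ) x

/-- **The per-representative identity**: `σ_pq(ρ_x) + σ_pq(ρ^O_x) = G(x) − G(cdual x)`. -/
lemma sigma_pq_add_flipOp {p q r s d : V} (hnp : NoPocketAt ends d r s) (hpd : p ≠ d)
    (hqd : q ≠ d) (hr : d ≠ r) (hs : d ≠ s) {ρ : Config E} (hρ : ρ ∈ RepD ends p q r s d)
    {x : Finset (Finset V) × Finset E} (hx : x ∈ L4 ends d r s ρ) :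
    sigma ends (assignX ends x ρ) p q + sigma ends (assignX ends x (flipOp ends d r s ρ)) p q =
      Gfun ends p q r s d ρ x - Gfun ends p q r s d ρ (cdual ends d r s ρ x) := by
  have hρO := flipOp_mem_RepD hr hs hρ
  have hxO : x ∈ L4 ends d r s (flipOp ends d r s ρ) := by rw [L4_flipOp hr hs]; exact hx
  have e1 := conn_pq_compl_assignX hnp hpd hqd hr hs hρ hx
  have e2 := conn_pq_compl_assignX hnp hpd hqd hr hs hρO hxO
  rw [flipOp_flipOp hr hs, cdual_flipOp hr hs] at e2
  unfold sigma Gfun Yc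
  by_cases hB : Conn ends (OneColourSwitch.compl (assignX ends x ρ)) p q <;>
    by_cases hD : Conn ends (OneColourSwitch.compl (assignX ends x (flipOp ends d r s ρ))) p q
  · have h1 := e1.1 hB
    have h2 := e2.1 hD
    simp only [hB, hD, h1, h2, if_true]
    ring
  · have h1 := e1.1 hB
    have h2 : ¬ Conn ends (assignX ends (cdual ends d r s ρ x) ρ) p q := fun h => hD (e2.2 h)
    simp only [hB, hD, h1, h2, if_true, if_false]
    ring
  · have h1 : ¬ Conn ends (assignX ends (cdual ends d r s ρ x) (flipOp ends d r s ρ)) p q :=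
      fun h => hB (e1.2 h)
    have h2 := e2.1 hD
    simp only [hB, hD, h1, h2, if_true, if_false]
    ring
  · have h1 : ¬ Conn ends (assignX ends (cdual ends d r s ρ x) (flipOp ends d r s ρ)) p q :=
      fun h => hB (e1.2 h)
    have h2 : ¬ Conn ends (assignX ends (cdual ends d r s ρ x) ρ) p q := fun h => hD (e2.2 h)
    simp only [hB, hD, h1, h2, if_false]
    ring

/-- The outside flip maps representatives to representatives, as a bijection. -/
lemma flipOp_bij {p q r s d : V} (hr : d ≠ r) (hs : d ≠ s) :
    ∀ ρ ∈ RepD ends p q r s d, flipOp ends d r s ρ ∈ RepD ends p q r s d :=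
  fun _ hρ => flipOp_mem_RepD hr hs hρ

/-- **The main inequality on the no-pocket class**: for every finite marked multigraph and
every non-mark `d` whose neighbours other than `r, s` are adjacent to `r` or `s`,
`Σ_{ω ∈ Sep, D(ω) ⊆ {d}} σ_pq · σ_rs ≤ 0`. -/
theorem dSignSum_nonpos_of_noPocket {p q r s d : V} (hnp : NoPocketAt ends d r s) (hpd : p ≠ d)
    (hqd : q ≠ d) (hr : d ≠ r) (hs : d ≠ s) : dSignSum ends p q r s d ≤ 0 := by
  have hsum : dSignSum ends p q r s d =
      ∑ ρ ∈ RepD ends p q r s d, ∑ x ∈ L4 ends d r s ρ,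
        sigma ends (assignX ends x ρ) p q * sigma ends (assignX ends x ρ) r s := by
    rw [dSignSum, ← Finset.sum_filter]
    rw [← sum_dOne_eq_sum_repD_L4 hnp hpd hqd hr hs (fun ω => sigma ends ω p q * sigma ends ω r s)]
    refine Finset.sum_congr ?_ (fun _ _ => rfl)
    ext ω
    simp [DOneSet]
  have hsumO : (∑ ρ ∈ RepD ends p q r s d, ∑ x ∈ L4 ends d r s ρ,
        sigma ends (assignX ends x ρ) p q * sigma ends (assignX ends x ρ) r s) =
      ∑ ρ ∈ RepD ends p q r s d, ∑ x ∈ L4 ends d r s ρ,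
        sigma ends (assignX ends x (flipOp ends d r s ρ)) p q *
          sigma ends (assignX ends x ρ) r s := by
    symm
    refine Finset.sum_nbij' (fun ρ => flipOp ends d r s ρ) (fun ρ => flipOp ends d r s ρ)
      (flipOp_bij hr hs) (flipOp_bij hr hs)
      (fun ρ _ => flipOp_flipOp hr hs ρ) (fun ρ _ => flipOp_flipOp hr hs ρ) ?_
    intro ρ hρ
    rw [L4_flipOp hr hs]
    refine Finset.sum_congr rfl (fun x hx => ?_)
    rw [sigma_rs_assignX_flipOp hnp hr hs hρ hx]
  have hkey : ∀ ρ ∈ RepD ends p q r s d,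
      ∑ x ∈ L4 ends d r s ρ,
        (sigma ends (assignX ends x ρ) p q + sigma ends (assignX ends x (flipOp ends d r s ρ)) p q) *
          sigma ends (assignX ends x ρ) r s ≤ 0 := by
    intro ρ hρ
    have hρO := flipOp_mem_RepD hr hs hρ
    have hGmono : ∀ x ∈ L4 ends d r s ρ, ∀ x' ∈ L4 ends d r s ρ, x ≤ x' →
        Gfun ends p q r s d ρ x ≤ Gfun ends p q r s d ρ x' := by
      intro x hx x' hx' hxx'
      have hxO : x ∈ L4 ends d r s (flipOp ends d r s ρ) := by rw [L4_flipOp hr hs]; exact hx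
      have hx'O : x' ∈ L4 ends d r s (flipOp ends d r s ρ) := by rw [L4_flipOp hr hs]; exact hx'
      unfold Gfun Yc
      exact add_le_add (ite_le_ite_of_imp (conn_pq_assignX_mono hnp hpd hqd hr hs hρ hxx' hx hx'))
        (ite_le_ite_of_imp (conn_pq_assignX_mono hnp hpd hqd hr hs hρO hxx' hxO hx'O))
    have hHanti : ∀ x ∈ L4 ends d r s ρ, ∀ x' ∈ L4 ends d r s ρ, x ≤ x' →
        sigma ends (assignX ends x' ρ) r s ≤ sigma ends (assignX ends x ρ) r s := by
      intro x hx x' hx' hxx'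
      unfold sigma
      exact sub_le_sub (ite_le_ite_of_imp (conn_rs_assignX_anti hnp hpd hqd hr hs hρ hxx' hx hx'))
        (ite_le_ite_of_imp (conn_rs_compl_assignX_mono hnp hpd hqd hr hs hρ hxx' hx hx'))
    have hH := sum_sub_dual_mul_nonpos_of_sublattice''
      (L := L4 ends d r s ρ) (c := cdual ends d r s ρ)
      (fun x hx => cdual_cdual ((mem_L4.1 hx).1.1) ((mem_L4.1 hx).1.2)) (cdual_antitone ρ)
      (fun _ _ hx hx' => L4_sup_mem hx hx') (fun _ _ hx hx' => L4_inf_mem hx hx')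
      (fun _ hx => cdual_mem_L4 hx) (G := Gfun ends p q r s d ρ)
      (H := fun x => sigma ends (assignX ends x ρ) r s) hGmono hHanti
    refine le_trans (le_of_eq ?_) hH
    refine Finset.sum_congr rfl (fun x hx => ?_)
    rw [sigma_pq_add_flipOp hnp hpd hqd hr hs hρ hx]
  have htwice : 2 * dSignSum ends p q r s d ≤ 0 := by
    calc 2 * dSignSum ends p q r s d
        = dSignSum ends p q r s d + dSignSum ends p q r s d := by ring
      _ = (∑ ρ ∈ RepD ends p q r s d, ∑ x ∈ L4 ends d r s ρ,
            sigma ends (assignX ends x ρ) p q * sigma ends (assignX ends x ρ) r s) +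
          ∑ ρ ∈ RepD ends p q r s d, ∑ x ∈ L4 ends d r s ρ,
            sigma ends (assignX ends x (flipOp ends d r s ρ)) p q *
              sigma ends (assignX ends x ρ) r s := by
          rw [← hsumO, ← hsum]
      _ = ∑ ρ ∈ RepD ends p q r s d, ∑ x ∈ L4 ends d r s ρ,
            (sigma ends (assignX ends x ρ) p q +
              sigma ends (assignX ends x (flipOp ends d r s ρ)) p q) *
              sigma ends (assignX ends x ρ) r s := by
          rw [← Finset.sum_add_distrib]
          refine Finset.sum_congr rfl (fun ρ _ => ?_)
          rw [← Finset.sum_add_distrib]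
          refine Finset.sum_congr rfl (fun x _ => ?_)
          ring
      _ ≤ 0 := Finset.sum_nonpos (fun ρ hρ => hkey ρ hρ)
  linarith

omit [Fintype V] [DecidableEq V] [Fintype E] [DecidableEq E] in
/-- `DOne` holds for every `Sep`-colouring when every non-mark other than `d` is adjacent to
`p` or `q`. -/
lemma DOne_of_adj {p q r s d : V}
    (hadj : ∀ x, Nonmark p q r s x → x ≠ d → ∃ e, ends e = s(x, p) ∨ ends e = s(x, q))
    {ω : Config E} (h : sep2 ends p q r s ω) : DOne ends r s d ω := by
  intro x hr hs hd hK hM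
  obtain ⟨e, he⟩ := hadj x (nonmark_of_mem_U2 h (Or.inl hK) hr hs) hd
  obtain ⟨⟨hpK, hqK⟩, ⟨hpM, hqM⟩⟩ := sep2_iff.1 h
  cases hc : ω e
  · rcases he with he | he
    · exact hpM (mem_M2_of_closed hM hc he)
    · exact hqM (mem_M2_of_closed hM hc he)
  · rcases he with he | he
    · exact hpK (mem_K2_of_open hK hc he)
    · exact hqK (mem_K2_of_open hK hc he)

/-- **`m9` on the single-`d` class without a pocket**: if every non-mark other than `d` is
adjacent to `p` or `q`, and every neighbour of `d` other than `r, s` is adjacent to `r` or `s`,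
then `Σ_{Sep} σ_pq · σ_rs ≤ 0`. -/
theorem m9SignSum_nonpos_of_singleD_noPocket {p q r s d : V} (hnp : NoPocketAt ends d r s)
    (hadj : ∀ x, Nonmark p q r s x → x ≠ d → ∃ e, ends e = s(x, p) ∨ ends e = s(x, q))
    (hpd : p ≠ d) (hqd : q ≠ d) (hr : d ≠ r) (hs : d ≠ s) : m9SignSum ends p q r s ≤ 0 := by
  have h : m9SignSum ends p q r s = dSignSum ends p q r s d := by
    unfold m9SignSum dSignSum
    refine Finset.sum_congr rfl (fun ω _ => ?_)
    by_cases hsep : sep2 ends p q r s ω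
    · simp [hsep, DOne_of_adj hadj hsep]
    · simp [hsep]
  rw [h]
  exact dSignSum_nonpos_of_noPocket hnp hpd hqd hr hs

end Theorem

end NoPocket

end Summit.Ventures.PercRepro2
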